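import Literature.AnabelianGeometry.EtaleTheta.Discharge.Sec2Cor29ChiCuspSectionDatumNegative
import Literature.AnabelianGeometry.EtaleTheta.Discharge.Sec2CuspStabSectionDatum
import Literature.AnabelianGeometry.EtaleTheta.Discharge.Sec2Def27OrbitsOfStandardTypeModelChi
import Literature.AnabelianGeometry.EtaleTheta.Discharge.Sec2InvEllOfCLevel
import HarnessLib

/-!
# [EtTh] Cor. 2.9 at the Kummer-carrying `χ′`: EVERY section cusp datum is `a`-stabilised — the obstruction of
# finding F-L2t12g9-1 is SECTION-INDEPENDENT (proof-only census certificate for GAP-LEDGER G-L2t12g9-1)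

S. Mochizuki, *The étale theta function and its Frobenioid-theoretic manifestations*, Publ. RIMS **45** (2009) [EtTh], §2:
discussion preceding Def. 2.1, PRIMS PDF p. 35 («`1 → Δ̄_Θ → D̄_x → G_K → 1`»), Prop. 2.2 (ii) p. 37 («the
`H¹(G_K, Δ̄_Θ)`-torsor of splittings»), Cor. 2.9 p. 43 [cite: MochizukiEtTh2009, Cor 2.9 p.43].
Cell abc-iut, layer L2, seat abc-iut-L2-t10 (gen 8), abc-iut-L2-lead row «χ′ CUSP-DATUM CENSUS» (ROWS #129). PROOF-ONLY
(no definition, no instance, no `Prop` fact). Inputs BY NAME: this seat's gen-6 constructor `PiCData.coverDataAxOfSection`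
(`D_x := Δ̄_Θ-preimage ⊔ incl(toHat(s(G_K)))`, `ThetaCoversAxOfSection`), abc-iut-L2-d3's R312 assembly
`CLevelData.temperedCoverDataOfHuuOfSection` (`ThetaCoversTemperedOfHuuOfSection`), abc-iut-L2-t12 g9's finding file
`Sec2Cor29ChiCuspSectionDatumNegative` (p489101: at THE section `sectionχ′ = inr`, `g_a := inclX(inl a)` CENTRALISES the
section image, hence stabilises the cusp datum, hence `¬hC1` and ONE `Aut_K(C̲)`-orbit of cusps).

THE POINT. p489101's witness used that `a` commutes with `inr σ`. For an ARBITRARY homomorphic section `s` of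
`Π^tp_X(χ′) = Γ ⋊_χ G_{ℚ_p} ↠ G_{ℚ_p}` — `s(σ) = ⟨g_σ, σ⟩ with `g_σ ∈ Γ` any 1-cocycle twist — `a` no longer centralises
`s(G_K)`, but since the χ-twist FIXES `a` (abc-iut's `actχ_gfpOf_zero`, `Sec2Def27OrbitsOfStandardTypeModelChi`) one has
`[inl a, s(σ)] = inl ⁅a, g_σ⁆ ∈ ⁅Δ^tp_X, Δ^tp_X⁆`, whose image in any `Π_C` lies in `⁅Δ_X, Δ_X⁆ ≤ Δ̄_Θ`-preimage; as the
`Δ̄_Θ`-preimage is normal, `incl(toHat(inl a))` NORMALISES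
`Δ̄_Θ-preimage ⊔ incl(toHat(s(G_K)))` — for every `s`, every profinite input bundle `I`, every `l`:
* §0 `conj_mem_sup_of_normal_left`, `mem_normalizer_sup_of_normal_left` — conjugating a join `N ⊔ S` with `N` normal;
* §1 (generic over ANY theta setting `D`, ANY `PiCData I`, ANY section `s`, ANY `x ∈ Π^tp_X`)
  **`PiCData.incl_toHat_mem_normalizer_sectionDx`**: if `x·s(σ)·x⁻¹·s(σ)⁻¹ ∈ ⁅Δ^tp_X, Δ^tp_X⁆` for all `σ`, then
  `incl(toHat x)` normalises the section cusp datum `I.sectionDx l s`;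
* §2 (at `χ′`) **`inl_gfpOf_zero_commutator_section_mem`**: the hypothesis of §1 holds for `x = inl a` and EVERY section `s`
  of `aug` at `modelχ′`; **`incl_toHat_inl_gfpOf_zero_mem_normalizer_sectionDx_modelχ'`**;
* §3 (the R312 assembly with an ARBITRARY section: all its binders bound variables)
  **`inclX_inl_gfpOf_zero_mem_cuspStabC_ofHuuOfSection`**, **`not_hC1_ofHuuOfSection`** (`l ≠ 1`): p489101's two χ′
  theorems with `sectionχ′` replaced by a bound section `s` (and THE completion `toPiCHat` by any completion `ιC`).
So no cocycle variant of `sectionχ′` (continuous or not, valued in `Π^tp_Y` or not, landing in `Huu` or not) yields a cusp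
datum meeting abc-iut-L2-d3's Cor. 2.9 hypothesis `hC1` at `χ′`: in module terms the normaliser of `Δ̄_Θ-preimage·s(G_K)`
meets `Δ_X` in the preimage of the `G_K`-FIXED vectors of `V := Δ_X/Δ̄_Θ-preimage ≅ (ℤ/l)²` for EVERY cocycle, and at `χ′`
`ā ∈ V^{G_K}` lies off the `X̲`-line. What WOULD carry print's count at `χ′` is a GEOMETRIC (compact, hIx) cusp datum —
GAP-LEDGER G-L2t12g9-1, new data, not built here.
HONEST FRAMING: semi-synthetic model; the section cusp datum is the SYNTHETIC `D̄_x`-preimage (this seat's gen-6 label), a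
statement about OUR typed objects only; nothing of [EtTh] is asserted or denied; no side is taken on [IUTchIII] Cor. 3.12;
typed ≠ proved; instantiated ≠ endorsed.
-/

noncomputable section

namespace Literature.AnabelianGeometry.EtaleTheta

open scoped commutatorElement Pointwise
open Literature.AnabelianGeometry.SemiGraphs ThetaCovers
open _root_.Topology

/-! ## §0. Group theory: conjugating a join `N ⊔ S` with `N` normal -/

section GroupTheory

variable {G : Type*} [Group G]

/-- If `N ⊴ G` and `g` conjugates every element of `S` into `N ⊔ S`, then `g` conjugates all of `N ⊔ S` into `N ⊔ S`
(`N ⊔ S = N·S`). [cite: MochizukiEtTh2009, Def 2.1 p.35] -/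
theorem conj_mem_sup_of_normal_left {N S : Subgroup G} [hN : N.Normal] {g : G}
    (hS : ∀ t ∈ S, g * t * g⁻¹ ∈ N ⊔ S) {y : G} (hy : y ∈ N ⊔ S) : g * y * g⁻¹ ∈ N ⊔ S := by
  have hy' : y ∈ ((N : Set G) * (S : Set G)) := by
    rw [← Subgroup.normal_mul]
    exact hy
  obtain ⟨n, hn, t, ht, rfl⟩ := hy'
  have h : g * (n * t) * g⁻¹ = (g * n * g⁻¹) * (g * t * g⁻¹) := by group
  rw [h]
  exact Subgroup.mul_mem _ (Subgroup.mem_sup_left (hN.conj_mem n hn g)) (hS t ht)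

/-- If `N ⊴ G` and both `g` and `g⁻¹` conjugate `S` into `N ⊔ S`, then `g` normalises `N ⊔ S`.
[cite: MochizukiEtTh2009, Def 2.1 p.35] -/
theorem mem_normalizer_sup_of_normal_left {N S : Subgroup G} [N.Normal] {g : G}
    (hS : ∀ t ∈ S, g * t * g⁻¹ ∈ N ⊔ S) (hS' : ∀ t ∈ S, g⁻¹ * t * g⁻¹⁻¹ ∈ N ⊔ S) :
    g ∈ Subgroup.normalizer ((N ⊔ S : Subgroup G) : Set G) := by
  rw [Subgroup.mem_normalizer_iff]
  intro y
  constructor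
  · exact conj_mem_sup_of_normal_left hS
  · intro hy
    have h := conj_mem_sup_of_normal_left hS' hy
    have h' : g⁻¹ * (g * y * g⁻¹) * g⁻¹⁻¹ = y := by group
    rwa [h'] at h

/-- In a semidirect product `N ⋊_φ G`: if `φ_{z.right}` FIXES `n`, then `[inl n, z] = inl ⁅n, z.left⁆`.
[cite: MochizukiEtTh2009, §1 p.12] -/
theorem SemidirectProduct.inl_mul_mul_inv_mul_inv_of_fixed {N H : Type*} [Group N] [Group H] {φ : H →* MulAut N}
    (n : N) (z : N ⋊[φ] H) (hfix : φ z.right n = n) :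
    (SemidirectProduct.inl n : N ⋊[φ] H) * z * (SemidirectProduct.inl n)⁻¹ * z⁻¹ =
      SemidirectProduct.inl (n * z.left * n⁻¹ * z.left⁻¹) := by
  have hfix' : φ z.right n⁻¹ = n⁻¹ := by rw [map_inv, hfix]
  have hφ : φ z.right (φ z.right⁻¹ z.left⁻¹) = z.left⁻¹ := by
    rw [← MulAut.mul_apply, ← map_mul, mul_inv_cancel, map_one, MulAut.one_apply]
  rw [← map_inv]
  refine SemidirectProduct.ext ?_ ?_
  · simp only [SemidirectProduct.mul_left, SemidirectProduct.inv_left, SemidirectProduct.mul_right,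
      SemidirectProduct.left_inl, SemidirectProduct.right_inl, map_one, MulAut.one_apply, one_mul, mul_one, hfix']
    rw [hφ]
  · rw [SemidirectProduct.mul_right, SemidirectProduct.mul_right, SemidirectProduct.mul_right, SemidirectProduct.inv_right,
      SemidirectProduct.right_inl, SemidirectProduct.right_inl, SemidirectProduct.right_inl, one_mul, mul_one,
      mul_inv_cancel]

end GroupTheory

/-! ## §1. Generic: an element whose commutators with the section lie in `⁅Δ^tp_X, Δ^tp_X⁆` normalises the section cusp datum -/

namespace ThetaSetting.PiCData

variable {p : ℕ} [Fact p.Prime] {D : ThetaSetting p} {PiC : Type} [Group PiC] [TopologicalSpace PiC]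
  [IsTopologicalGroup PiC] [T2Space PiC] (I : D.PiCData PiC) (l : ℕ)

/-- `incl(toHat(⁅Δ^tp_X, Δ^tp_X⁆)) ⊆ Δ̄_Θ`-preimage: `toHat(Δ^tp_X) ≤ Δ_X`, `incl(Δ_X) = I.DeltaX` and
`⁅I.DeltaX, I.DeltaX⁆ ≤ I.barTheta l` (this seat's `commutator_deltaX_le_barTheta`). [cite: MochizukiEtTh2009, Def 2.1 p.35] -/
theorem incl_toHat_mem_barTheta_of_mem_commutator {y : D.PiTemp} (hy : y ∈ ⁅D.DeltaTemp, D.DeltaTemp⁆) :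
    I.incl (D.toHat y) ∈ I.barTheta l := by
  have h1 : D.toHat.toMonoidHom y ∈ (⁅D.DeltaTemp, D.DeltaTemp⁆).map D.toHat.toMonoidHom := ⟨y, hy, rfl⟩
  rw [Subgroup.map_commutator] at h1
  have h2 : D.DeltaTemp.map D.toHat.toMonoidHom ≤ D.DeltaHat := Subgroup.le_topologicalClosure _
  have h3 : D.toHat y ∈ ⁅D.DeltaHat, D.DeltaHat⁆ := Subgroup.commutator_mono h2 h2 h1
  have h4 : I.incl.toMonoidHom (D.toHat y) ∈ (⁅D.DeltaHat, D.DeltaHat⁆).map I.incl.toMonoidHom := ⟨_, h3, rfl⟩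
  rw [Subgroup.map_commutator] at h4
  exact I.commutator_deltaX_le_barTheta l h4

/-- **Generic normaliser lemma.** For ANY section `s : G_K → Π^tp_X` and ANY `x ∈ Π^tp_X` whose commutators with the
`s(σ)` all lie in `⁅Δ^tp_X, Δ^tp_X⁆`, the element `incl(toHat x) ∈ Π_C` NORMALISES the section cusp datum
`D_x = Δ̄_Θ-preimage ⊔ incl(toHat(s(G_K)))`. [cite: MochizukiEtTh2009, Def 2.1 p.35] -/
theorem incl_toHat_mem_normalizer_sectionDx (e : D.OncePuncturedData) (s : ↥D.GK →* D.PiTemp) {x : D.PiTemp}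
    (hx : ∀ σ : ↥D.GK, x * s σ * x⁻¹ * (s σ)⁻¹ ∈ ⁅D.DeltaTemp, D.DeltaTemp⁆) :
    I.incl (D.toHat x) ∈ Subgroup.normalizer ((I.sectionDx l s : Subgroup PiC) : Set PiC) := by
  haveI : (I.barTheta l).Normal := I.barTheta_normal l e
  haveI : D.DeltaTemp.Normal := MonoidHom.normal_ker _
  haveI : (⁅D.DeltaTemp, D.DeltaTemp⁆).Normal := Subgroup.commutator_normal _ _
  -- the inverse also satisfies the commutator hypothesis
  have hx' : ∀ σ : ↥D.GK, x⁻¹ * s σ * x⁻¹⁻¹ * (s σ)⁻¹ ∈ ⁅D.DeltaTemp, D.DeltaTemp⁆ := fun σ => by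
    have h := Subgroup.Normal.conj_mem inferInstance _ (Subgroup.inv_mem _ (hx σ)) x⁻¹
    have h' : x⁻¹ * (x * s σ * x⁻¹ * (s σ)⁻¹)⁻¹ * x⁻¹⁻¹ = x⁻¹ * s σ * x⁻¹⁻¹ * (s σ)⁻¹ := by group
    rwa [h'] at h
  -- conjugating a generator of the section image by `incl(toHat x^{±1})`
  have key : ∀ {z : D.PiTemp}, (∀ σ : ↥D.GK, z * s σ * z⁻¹ * (s σ)⁻¹ ∈ ⁅D.DeltaTemp, D.DeltaTemp⁆) →
      ∀ t ∈ I.sectionRange s, I.incl (D.toHat z) * t * (I.incl (D.toHat z))⁻¹ ∈ I.barTheta l ⊔ I.sectionRange s := by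
    intro z hz t ht
    obtain ⟨σ, rfl⟩ := (I.mem_sectionRange_iff s t).mp ht
    have hdec : I.incl (D.toHat z) * I.incl (D.toHat (s σ)) * (I.incl (D.toHat z))⁻¹ =
        I.incl (D.toHat (z * s σ * z⁻¹ * (s σ)⁻¹)) * I.incl (D.toHat (s σ)) := by
      simp only [map_mul, map_inv]
      group
    rw [hdec]
    exact Subgroup.mul_mem _ (Subgroup.mem_sup_left (I.incl_toHat_mem_barTheta_of_mem_commutator l (hz σ)))
      (Subgroup.mem_sup_right (I.incl_toHat_section_mem s σ))
  change I.incl (D.toHat x) ∈ Subgroup.normalizer (((I.barTheta l ⊔ I.sectionRange s : Subgroup PiC)) : Set PiC)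
  refine mem_normalizer_sup_of_normal_left (key hx) fun t ht => ?_
  have h := key hx' t ht
  simpa only [map_inv] using h

end ThetaSetting.PiCData

/-! ## §2. Generic over a `MuTwoSetting`: the R312 assembly — `inclX z ∈ cuspStabC` from the COMMUTATOR condition
(abc-iut-L2-d3's `…_of_commute` lemmas of `Sec2CuspStabSectionDatum` with `Commute z (s σ)` weakened to
`z·s(σ)·z⁻¹·s(σ)⁻¹ ∈ ⁅Δ^tp_X, Δ^tp_X⁆`) -/

namespace MuTwoSetting.CLevelData

variable {p : ℕ} [Fact p.Prime] {M : MuTwoSetting p}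
variable {PC : Type} [Group PC] [TopologicalSpace PC] [IsTopologicalGroup PC] [T2Space PC]

/-- **Every `z ∈ Π^tp_X` whose commutators with the section lie in `⁅Δ^tp_X, Δ^tp_X⁆` normalises
`ιC⁻¹(Δ̄_Θ-preimage) · inclX(s(G_K))`** (abc-iut-L2-d3's `inclX_mem_normalizer_sectionDatum_of_commute` with the commuting
hypothesis weakened: conjugation moves each `inclX(s σ)` by an element of the NORMAL first factor).
[cite: MochizukiEtTh2009, Cor 2.9 p.43] -/
theorem inclX_mem_normalizer_sectionDatum_of_commutator_mem (e : M.CLevelData) (ιC : M.GtpC →ₜ* PC)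
    (hιC : IsProfiniteCompletion ιC) (op : M.toThetaSetting.OncePuncturedData) (l : ℕ) (s : ↥M.GK →* M.PiTemp)
    (z : M.PiTemp) (hz : ∀ σ, z * s σ * z⁻¹ * (s σ)⁻¹ ∈ ⁅M.DeltaTemp, M.DeltaTemp⁆) :
    M.inclX z ∈ Subgroup.normalizer
      ((((e.piCDataOf ιC hιC).barTheta l).comap ιC.toMonoidHom ⊔ s.range.map M.inclX : Subgroup M.GtpC) : Set M.GtpC) := by
  rw [← e.comap_sectionDx_eq_sup ιC hιC op l s]
  refine Subgroup.le_normalizer_comap ιC.toMonoidHom ?_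
  rw [Subgroup.mem_comap]
  have h := (e.piCDataOf ιC hιC).incl_toHat_mem_normalizer_sectionDx l op s hz
  rwa [e.piCDataOf_incl_toHat ιC hιC] at h

section Identities

variable (e : M.CLevelData) (ιC : M.GtpC →ₜ* PC) (hιC : IsProfiniteCompletion ιC)
  (hinj : Function.Injective ιC) (op : M.toThetaSetting.OncePuncturedData) {l : ℕ} (hodd : Odd l)
  (s : ↥M.GK →* M.PiTemp) (hsa : ∀ σ, M.aug (s σ) = (σ : GQp p)) (hsZ : ∀ σ, M.toZ (s σ) = 1)
  (hιell : ∀ c ∈ (e.piCDataOf ιC hιC).augGK.ker, c ∉ (e.piCDataOf ιC hιC).PiX →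
    ∀ d ∈ (e.piCDataOf ιC hιC).PiX ⊓ (e.piCDataOf ιC hιC).augGK.ker,
      c * d * c⁻¹ * d ∈ (e.piCDataOf ιC hιC).barTheta l)
  (hN : ((M.GtpXu l).map M.inclX).Normal) (hY : (M.GtpY.map M.inclX).Normal)
  {E : M.toThetaSetting.EtaleThetaData} (C : E.DoubleUnderline l) (hK : M.barKerTp l ≤ C.Huu)
  (hsH : ∀ σ, s σ ∈ C.Huu) {g : M.GtpC} (hgX : g ∉ M.inclX.range) (hι : C.IotaStable (e.conjX g))

/-- **Every `z ∈ Π^tp_X` whose commutators with the section lie in `⁅Δ^tp_X, Δ^tp_X⁆` lies in the cusp stabiliser** of the R312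
assembly (abc-iut-L2-d3's `inclX_mem_cuspStabC_ofHuuOfSection_of_commute`, commuting hypothesis weakened).
[cite: MochizukiEtTh2009, Cor 2.9 p.43] -/
theorem inclX_mem_cuspStabC_ofHuuOfSection_of_commutator_mem (z : M.PiTemp)
    (hz : ∀ σ, z * s σ * z⁻¹ * (s σ)⁻¹ ∈ ⁅M.DeltaTemp, M.DeltaTemp⁆) :
    M.inclX z ∈
      (e.temperedCoverDataOfHuuOfSection ιC hιC hinj op hodd s hsa hsZ hιell hN hY C hK hsH hgX hι).cuspStabC := by
  rw [e.temperedCoverDataOfHuuOfSection_cuspStabC ιC hιC hinj op hodd s hsa hsZ hιell hN hY C hK hsH hgX hι]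
  exact e.inclX_mem_normalizer_sectionDatum_of_commutator_mem ιC hιC op l s z hz

/-- **`¬ hC1`** for the R312 assembly from a degree-one `z` with commutators in `⁅Δ^tp_X, Δ^tp_X⁆` (`l ≥ 2`).
[cite: MochizukiEtTh2009, Cor 2.9 p.43] -/
theorem temperedCoverDataOfHuuOfSection_not_hC1_of_commutator_mem (hl2 : 2 ≤ l) (z : M.PiTemp)
    (hz : ∀ σ, z * s σ * z⁻¹ * (s σ)⁻¹ ∈ ⁅M.DeltaTemp, M.DeltaTemp⁆) (hz1 : M.toZ z = Multiplicative.ofAdd 1) :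
    let T := e.temperedCoverDataOfHuuOfSection ιC hιC hinj op hodd s hsa hsZ hιell hN hY C hK hsH hgX hι
    ¬ (T.cuspStabC ⊓ T.tp T.PiX ≤ T.tp T.PiXu) :=
  (e.temperedCoverDataOfHuuOfSection ιC hιC hinj op hodd s hsa hsZ hιell hN hY C hK hsH hgX hι).not_hC1_of_mem_cuspStabC
    (e.inclX_mem_cuspStabC_ofHuuOfSection_of_commutator_mem ιC hιC hinj op hodd s hsa hsZ hιell hN hY C hK hsH hgX hι z hz)
    (by rw [temperedCoverDataOfHuuOfSection_tp_PiX]; exact ⟨z, rfl⟩)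
    (e.inclX_not_mem_tp_PiXu_ofHuuOfSection_of_toZ_eq_one ιC hιC hinj op hodd s hsa hsZ hιell hN hY C hK hsH hgX hι hl2
      z hz1)

/-- **All six `Aut_K`-orbit counts are ONE** for the R312 assembly from a degree-one `z` with commutators in `⁅Δ^tp_X, Δ^tp_X⁆`
(given `μ_l ⊆ K` in the typed form `HasMuL`). [cite: MochizukiEtTh2009, Cor 2.9 p.43] -/
theorem temperedCoverDataOfHuuOfSection_natCard_cuspOrbits_six_eq_one_of_commutator_mem (z : M.PiTemp)
    (hz : ∀ σ, z * s σ * z⁻¹ * (s σ)⁻¹ ∈ ⁅M.DeltaTemp, M.DeltaTemp⁆) (hz1 : M.toZ z = Multiplicative.ofAdd 1)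
    (hmu : (e.temperedCoverDataOfHuuOfSection ιC hιC hinj op hodd s hsa hsZ hιell hN hY C hK hsH hgX hι).HasMuL) :
    let T := e.temperedCoverDataOfHuuOfSection ιC hιC hinj op hodd s hsa hsZ hιell hN hY C hK hsH hgX hι
    ∀ S ∈ [T.tp T.PiXuu ⊓ T.PiCdot, T.tp T.PiCu ⊓ T.PiCdot, T.tp T.PiCuu ⊓ T.PiCdot, T.tp T.PiXuu, T.tp T.PiCu,
      T.tp T.PiCuu], Nat.card (T.cuspOrbits S) = 1 :=
  (e.temperedCoverDataOfHuuOfSection ιC hιC hinj op hodd s hsa hsZ hιell hN hY C hK hsH hgX hι)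
      |>.natCard_cuspOrbits_six_eq_one_of_mem_cuspStabC
    (e.temperedCoverDataOfHuuOfSection_hTheta ιC hιC hinj op hodd s hsa hsZ hιell hN hY C hK hsH hgX hι) hmu
    (e.inclX_mem_cuspStabC_ofHuuOfSection_of_commutator_mem ιC hιC hinj op hodd s hsa hsZ hιell hN hY C hK hsH hgX hι z hz)
    (e.temperedCoverDataOfHuuOfSection_hgen_of_toZ_eq_one ιC hιC hinj op hodd s hsa hsZ hιell hN hY C hK hsH hgX hι z hz1)

/-- **`¬ Cor29_card`** for the R312 assembly from a degree-one `z` with commutators in `⁅Δ^tp_X, Δ^tp_X⁆` (`l ≥ 3`, `HasMuL`):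
the member `C̲` has ONE orbit, print's count is `(l+1)/2 ≥ 2`. [cite: MochizukiEtTh2009, Cor 2.9 p.43] -/
theorem temperedCoverDataOfHuuOfSection_not_cor29_card_of_commutator_mem (hl3 : 3 ≤ l) (z : M.PiTemp)
    (hz : ∀ σ, z * s σ * z⁻¹ * (s σ)⁻¹ ∈ ⁅M.DeltaTemp, M.DeltaTemp⁆) (hz1 : M.toZ z = Multiplicative.ofAdd 1)
    (hmu : (e.temperedCoverDataOfHuuOfSection ιC hιC hinj op hodd s hsa hsZ hιell hN hY C hK hsH hgX hι).HasMuL) :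
    ¬ (e.temperedCoverDataOfHuuOfSection ιC hιC hinj op hodd s hsa hsZ hιell hN hY C hK hsH hgX hι).Cor29_card :=
  (e.temperedCoverDataOfHuuOfSection ιC hιC hinj op hodd s hsa hsZ hιell hN hY C hK hsH hgX hι)
      |>.not_cor29_card_of_mem_cuspStabC hl3 hmu
    (e.inclX_mem_cuspStabC_ofHuuOfSection_of_commutator_mem ιC hιC hinj op hodd s hsa hsZ hιell hN hY C hK hsH hgX hι z hz)
    (e.temperedCoverDataOfHuuOfSection_hgen_of_toZ_eq_one ιC hιC hinj op hodd s hsa hsZ hιell hN hY C hK hsH hgX hι z hz1)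

end Identities

end MuTwoSetting.CLevelData

/-! ## §3. At `χ′`: the χ-twist fixes `a`, so `[inl a, s(σ)] ∈ ⁅Δ^tp_X, Δ^tp_X⁆` for EVERY section `s` — the collapse is
SECTION-INDEPENDENT -/

namespace SettingModel

open ThetaSetting

variable (p : ℕ) [Fact p.Prime]

/-- **For EVERY homomorphic section `s` of `Π^tp_X(χ′) ↠ G_{ℚ_p}` and every `σ`:
`[inl a, s(σ)] = inl ⁅a, (s σ).left⁆`.** [cite: MochizukiEtTh2009, Prop 2.2 (ii) p.37] -/
theorem inl_gfpOf_zero_commutator_section_eq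
    (s : ↥(MuTwoSetting.inversionModelχ' p).GK →* (MuTwoSetting.inversionModelχ' p).PiTemp)
    (σ : ↥(MuTwoSetting.inversionModelχ' p).GK) :
    (SemidirectProduct.inl (gfpOf (FreeGroup.of 0)) : PiTpχ p) * s σ * (SemidirectProduct.inl (gfpOf (FreeGroup.of 0)))⁻¹ *
        (s σ)⁻¹ =
      SemidirectProduct.inl (gfpOf (FreeGroup.of 0) * (s σ).left * (gfpOf (FreeGroup.of 0))⁻¹ * (s σ).left⁻¹) :=
  SemidirectProduct.inl_mul_mul_inv_mul_inv_of_fixed _ _ (actχ_gfpOf_zero p _)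

/-- **… and it lies in `⁅Δ^tp_X, Δ^tp_X⁆`** (`inl Γ ⊆ Δ^tp_X = Ker aug`). No hypothesis on `s` at all: only that the χ-twist fixes
`a`. [cite: MochizukiEtTh2009, Prop 2.2 (ii) p.37] -/
theorem inl_gfpOf_zero_commutator_section_mem
    (s : ↥(MuTwoSetting.inversionModelχ' p).GK →* (MuTwoSetting.inversionModelχ' p).PiTemp)
    (σ : ↥(MuTwoSetting.inversionModelχ' p).GK) :
    (SemidirectProduct.inl (gfpOf (FreeGroup.of 0)) : PiTpχ p) * s σ * (SemidirectProduct.inl (gfpOf (FreeGroup.of 0)))⁻¹ *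
        (s σ)⁻¹ ∈ ⁅(MuTwoSetting.inversionModelχ' p).DeltaTemp, (MuTwoSetting.inversionModelχ' p).DeltaTemp⁆ := by
  rw [inl_gfpOf_zero_commutator_section_eq]
  have hinl : ∀ g : Gfp, (SemidirectProduct.inl g : PiTpχ p) ∈ (MuTwoSetting.inversionModelχ' p).DeltaTemp := fun g => by
    rw [TemperedCurve.DeltaTemp, MonoidHom.mem_ker]
    rfl
  have h := Subgroup.commutator_mem_commutator (hinl (gfpOf (FreeGroup.of 0))) (hinl (s σ).left)
  rwa [commutatorElement_def, ← map_mul, ← map_inv, ← map_mul, ← map_inv, ← map_mul] at h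

/-- `toZ(a) = 1 ∈ Z`: `a` is a `Z`-generator (degree one) at `χ′`. [cite: MochizukiEtTh2009, §1 p.12] -/
theorem toZ_inl_gfpOf_zero_inversionModelχ' :
    (MuTwoSetting.inversionModelχ' p).toZ (SemidirectProduct.inl (gfpOf (FreeGroup.of 0))) = Multiplicative.ofAdd 1 :=
  toZ_inl_gfpOf_zero p

section OfHuuOfSection

variable {PC : Type} [Group PC] [TopologicalSpace PC] [IsTopologicalGroup PC] [T2Space PC]
  (ιC : (MuTwoSetting.inversionModelχ' p).GtpC →ₜ* PC) (hιC : IsProfiniteCompletion ιC) (hinj : Function.Injective ιC)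
  (eX : (ThetaSetting.modelχ' p).OncePuncturedData) {l : ℕ} (hodd : Odd l)
  (s : ↥(MuTwoSetting.inversionModelχ' p).GK →* (MuTwoSetting.inversionModelχ' p).PiTemp)
  (hsa : ∀ σ, (MuTwoSetting.inversionModelχ' p).aug (s σ) = (σ : GQp p))
  (hsZ : ∀ σ, (MuTwoSetting.inversionModelχ' p).toZ (s σ) = 1)
  (hιell : ∀ c ∈ ((cLevelDataInvχ' p).piCDataOf ιC hιC).augGK.ker, c ∉ ((cLevelDataInvχ' p).piCDataOf ιC hιC).PiX →
    ∀ d ∈ ((cLevelDataInvχ' p).piCDataOf ιC hιC).PiX ⊓ ((cLevelDataInvχ' p).piCDataOf ιC hιC).augGK.ker,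
      c * d * c⁻¹ * d ∈ ((cLevelDataInvχ' p).piCDataOf ιC hιC).barTheta l)
  (hN : (((MuTwoSetting.inversionModelχ' p).GtpXu l).map (MuTwoSetting.inversionModelχ' p).inclX).Normal)
  (hY : ((MuTwoSetting.inversionModelχ' p).GtpY.map (MuTwoSetting.inversionModelχ' p).inclX).Normal)
  {E : (ThetaSetting.modelχ' p).EtaleThetaData} (C : E.DoubleUnderline l)
  (hK : (MuTwoSetting.inversionModelχ' p).barKerTp l ≤ C.Huu) (hsH : ∀ σ, s σ ∈ C.Huu)
  {g : (MuTwoSetting.inversionModelχ' p).GtpC} (hgX : g ∉ (MuTwoSetting.inversionModelχ' p).inclX.range)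
  (hι : C.IotaStable ((cLevelDataInvχ' p).conjX g))

/-- **`g_a := inclX(inl a) ∈ T.cuspStabC` for the R312 assembly at `χ′` over ANY section `s`** (any completion `ιC`, any
`X̲̲ = C.Huu`, any inversion `g`, any `l`). [cite: MochizukiEtTh2009, Def 2.1 p.35] -/
theorem inclX_inl_gfpOf_zero_mem_cuspStabC_ofHuuOfSection :
    (MuTwoSetting.inversionModelχ' p).inclX (SemidirectProduct.inl (gfpOf (FreeGroup.of 0))) ∈
      ((cLevelDataInvχ' p).temperedCoverDataOfHuuOfSection ιC hιC hinj eX hodd s hsa hsZ hιell hN hY C hK hsH hgX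
        hι).cuspStabC :=
  (cLevelDataInvχ' p).inclX_mem_cuspStabC_ofHuuOfSection_of_commutator_mem ιC hιC hinj eX hodd s hsa hsZ hιell hN hY C hK
    hsH hgX hι _ (inl_gfpOf_zero_commutator_section_mem p s)

/-- **SECTION-INDEPENDENCE of finding F-L2t12g9-1, clause `hC1`**: for the R312 assembly at `χ′` over EVERY section `s`
(`l ≥ 2`), abc-iut-L2-d3's Cor. 2.9 hypothesis `hC1` FAILS — the stabiliser of the section cusp datum meets `Π^tp_X` outside
`Π^tp_{X̲}` (witness `g_a`). [cite: MochizukiEtTh2009, Cor 2.9 p.43] -/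
theorem not_hC1_ofHuuOfSection_inversionModelχ' (hl2 : 2 ≤ l) :
    let T := (cLevelDataInvχ' p).temperedCoverDataOfHuuOfSection ιC hιC hinj eX hodd s hsa hsZ hιell hN hY C hK hsH hgX hι
    ¬ (T.cuspStabC ⊓ T.tp T.PiX ≤ T.tp T.PiXu) :=
  (cLevelDataInvχ' p).temperedCoverDataOfHuuOfSection_not_hC1_of_commutator_mem ιC hιC hinj eX hodd s hsa hsZ hιell hN hY C
    hK hsH hgX hι hl2 _ (inl_gfpOf_zero_commutator_section_mem p s) (toZ_inl_gfpOf_zero_inversionModelχ' p)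

/-- **SECTION-INDEPENDENCE, the six counts**: for the R312 assembly at `χ′` over EVERY section `s`, given the typed `μ_l ⊆ K`
(`HasMuL`), each of `Ẋ̲̲, Ċ̲, Ċ̲̲, X̲̲, C̲, C̲̲` has exactly ONE `Aut_K`-orbit of cusps (print: `(l+1)/2`).
[cite: MochizukiEtTh2009, Cor 2.9 p.43] -/
theorem natCard_cuspOrbits_six_eq_one_ofHuuOfSection_inversionModelχ'
    (hmu : ((cLevelDataInvχ' p).temperedCoverDataOfHuuOfSection ιC hιC hinj eX hodd s hsa hsZ hιell hN hY C hK hsH hgX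
      hι).HasMuL) :
    let T := (cLevelDataInvχ' p).temperedCoverDataOfHuuOfSection ιC hιC hinj eX hodd s hsa hsZ hιell hN hY C hK hsH hgX hι
    ∀ S ∈ [T.tp T.PiXuu ⊓ T.PiCdot, T.tp T.PiCu ⊓ T.PiCdot, T.tp T.PiCuu ⊓ T.PiCdot, T.tp T.PiXuu, T.tp T.PiCu,
      T.tp T.PiCuu], Nat.card (T.cuspOrbits S) = 1 :=
  (cLevelDataInvχ' p).temperedCoverDataOfHuuOfSection_natCard_cuspOrbits_six_eq_one_of_commutator_mem ιC hιC hinj eX hodd s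
    hsa hsZ hιell hN hY C hK hsH hgX hι _ (inl_gfpOf_zero_commutator_section_mem p s) (toZ_inl_gfpOf_zero_inversionModelχ' p)
    hmu

/-- **SECTION-INDEPENDENCE, `¬ Cor29_card`**: for the R312 assembly at `χ′` over EVERY section `s` (`l ≥ 3`, `HasMuL`), the typed
Cor. 2.9 count statement is FALSE. [cite: MochizukiEtTh2009, Cor 2.9 p.43] -/
theorem not_cor29_card_ofHuuOfSection_inversionModelχ' (hl3 : 3 ≤ l)
    (hmu : ((cLevelDataInvχ' p).temperedCoverDataOfHuuOfSection ιC hιC hinj eX hodd s hsa hsZ hιell hN hY C hK hsH hgX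
      hι).HasMuL) :
    ¬ ((cLevelDataInvχ' p).temperedCoverDataOfHuuOfSection ιC hιC hinj eX hodd s hsa hsZ hιell hN hY C hK hsH hgX
      hι).Cor29_card :=
  (cLevelDataInvχ' p).temperedCoverDataOfHuuOfSection_not_cor29_card_of_commutator_mem ιC hιC hinj eX hodd s hsa hsZ hιell
    hN hY C hK hsH hgX hι hl3 _ (inl_gfpOf_zero_commutator_section_mem p s) (toZ_inl_gfpOf_zero_inversionModelχ' p) hmu

/-- **The HasMuL-discharged form** (`l` odd, `3 ≤ l`, `l ∣ p − 1`): for the R312 assembly at `χ′` over EVERY section `s`,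
`T.HasMuL` HOLDS (this seat's gen-7 `temperedCoverDataOfHuuOfSection_hasMuL` fed with `hμ_inversionModelχ'_of_dvd_pred`) and
`¬ T.Cor29_card` — whatever cocycle twist of the Galois section is used, the SYNTHETIC section cusp datum never carries print's
count at `χ′`. [cite: MochizukiEtTh2009, Cor 2.9 p.43] -/
theorem hasMuL_and_not_cor29_card_ofHuuOfSection_inversionModelχ' (hl3 : 3 ≤ l) (hl : l ∣ p - 1) :
    ((cLevelDataInvχ' p).temperedCoverDataOfHuuOfSection ιC hιC hinj eX hodd s hsa hsZ hιell hN hY C hK hsH hgX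
        hι).HasMuL ∧
      ¬ ((cLevelDataInvχ' p).temperedCoverDataOfHuuOfSection ιC hιC hinj eX hodd s hsa hsZ hιell hN hY C hK hsH hgX
        hι).Cor29_card :=
  have hmu := (cLevelDataInvχ' p).temperedCoverDataOfHuuOfSection_hasMuL ιC hιC hinj eX hodd s hsa hsZ hιell hN hY C hK hsH
    hgX hι (hμ_inversionModelχ'_of_dvd_pred p hl)
  ⟨hmu, not_cor29_card_ofHuuOfSection_inversionModelχ' p ιC hιC hinj eX hodd s hsa hsZ hιell hN hY C hK hsH hgX hι hl3 hmu⟩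

end OfHuuOfSection

end SettingModel

end Literature.AnabelianGeometry.EtaleTheta

end
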